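import Literature.MathematicalPhysics.QuantumFieldTheory.Balaban1983to89.B5Eq120IterProof

/-!
# `Balaban1983to89.B5HierAxialGaugeV1` — T. Bałaban, *Propagators and renormalization transformations for lattice gauge
theories. I*, Commun. Math. Phys. **95** (1984) 17–40 [Balaban1984PropagatorsI], pp. 20–21: the HIERARCHICAL BLOCK-AXIAL
GAUGE behind (1.17) ⟹ (1.23) — for every field `A` there is EXACTLY ONE restricted gauge transformation `λ ∈ N(Q′_k)`
putting all the averages `Q_jA^λ`, `j < k`, in the block axial gauge — proved CONCRETELY on the V1 lattice calculus

statement-level skeleton of published theorems with citation tags; proofs where landed; nothing here is a claim about the Yang–Mills mass gap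

PDF held: `paper:balaban1984-cmp95-propagators-rt-i` (pp. 20–21 = PDF pp. 4–5, read as images on the page renders
`run/shared/lean/pub/pub-balaban/b2b-balaban-ref1/pages/1984-cmp95-propagators-rt-I/…-p004-x2.png`, `…-p005-x2.png`).

WHAT IS REPRODUCED.  SKELETON row `B5.Eq1.23`, MIDDLE TERM of (1.23) (owner r02, ROWS-B5 v1.6: «(1.23) middle term (HierGauge
abstract only)» — absent): in
  «(1.17) = z^{(k)} ∫dA δ(B − Q_kA)(∫dλ′ δ(Q′_kλ′)·δ_Ax(Q_{k−1}A + ∂^{L^{−1}}Q′_{k−1}λ′)·…·δ_Ax(A + ∂^ηλ′))·… = z′^{(k)} ∫dA δ(B − Q_kA) …  (1.23)»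
the λ′-integral of the axial δ-functions is absorbed into the numerical factor `z′^{(k)}`.  Its content (p. 20: «The δ-function
δ(B − Q_kA) is invariant with respect to gauge transformations λ satisfying Q′_kλ = 0 and we can look at the integral (1.17) as
obtained by removing this gauge freedom by the help of the δ-functions δ_Ax») is the statement that the block axial conditions
`δ_Ax(Q_{k−1}A^λ)·…·δ_Ax(A^λ)` are a COMPLETE and UNAMBIGUOUS gauge fixing of the residual group `N(Q′_k) = {λ : Q′_kλ = 0}`:
for every `A` there is exactly one `λ ∈ N(Q′_k)` with all `Q_jA^λ`, `0 ≤ j < k`, axial.  The tree has this as the ABSTRACT lemma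
`B5.HierGauge.complete` / `unique` over nested block maps (B5.lean §C.1, GAPS G-B5-01R; «What is NOT formalised: the
identification of the paper's lattices/averages with (X, π, r) (routine)»).  THIS FILE does that identification on the
cross-paper carrier of record `LatticeFieldCalculus` (V1): `Q_j = bondAvgIter j` ((1.18)), `Q′_j = siteAvgIter j` ((1.20)),
`A^λ = gaugeShift c λ A = A − ∂λ` ((1.4), fine lattice factor `c`, `c = η⁻¹` in print), `δ_Ax` = `IsAxial` ((1.10), staircase
contours `Γ_{y,x}` = `stairSum`, centred blocks — DIVERGENCE F3 of `LatticeFieldCalculus`), and PROVES: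
* `hierAxial_existsUnique` — for `k ≤ m + K` (standing range), `c ≠ 0`, every `A : VecField P 0 V`:
  `∃! λ, siteAvgIter k λ = 0 ∧ ∀ j < k, IsAxial (bondAvgIter j (gaugeShift c λ A))`;
* the two halves `hierAxial_exists` (= `HierGauge.complete`: the top-down construction «level by level, from the unit lattice
  down to T_η») and `hierAxial_unique` (= `HierGauge.unique`);
* the dictionary `isAxial_gaugeShift_iff` — by (1.20) at level `j` (p38's `B5Eq120IterProof.bondAvgIter_gaugeShift`:
  `Q_jA^λ = Q_jA − ∂^{(j)}Q′_jλ`, coarse factor `c/L^j`) and the telescoping of `∂` along the staircase (`stairSum_grad`),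
  «`Q_jA^λ` axial» ⟺ `(Q′_jλ)(x) − (Q′_jλ)(y) = (L^j/c)·(Q_jA)(Γ_{y,x})` for `x ∈ B(y)` — the block-axial DATA of `Q′_jλ` are
  prescribed by `A`;
* the LINEAR-ALGEBRA form used by the Faddeev–Popov constant (`B5Eq123Constants.map_orbitLin_eq_smul` hypothesis `hbij`, p22's
  `B5ChangeOfGauge123` coordinates `e`): `kernel_trivial` (`Q′_kλ = 0` and all `Q_j(∂λ)` axial ⟹ `λ = 0`) and
  `fibre_decomposition` (every `A` is `(all-levels-axial) + ∂λ` with `λ ∈ N(Q′_k)`, uniquely).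
Values in any real vector space `V` (the statement is linear, «𝔤-valued λ reduce to ℝ-valued components», B5.lean §C.1).

NOT CERTIFIED HERE: any integral (the λ′-integral itself is `B5Eq123Constants` / `B5ChangeOfGauge123` §2 once this bijection is
fed in); the torus-carrier version of the same lemma (the B5 owner's typed tower `B5SectBStatements.towerM/Qk/Qsk/AxAll`) is
this seat's `B5Eq123Torus.hierGauge_exists/unique` (companion file; no bridge between the two carriers is claimed here).
RELATION TO TREE MATERIAL: `B5.HierGauge.*` (abstract; its `hsec` is required at ALL levels, which the V1 block maps satisfy
only in the standing range — hence the two short inductions are redone here with the range hypothesis, same proofs);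
`Beta.AveragingContours.axialGauge_tree…` / `B6AxialGaugeDictionary` (ONE level, ℤ^d / Tor carriers) are not used.

Unit `lit-balaban-p37` gen 2 (Phase-2 proof seat p37; literature-prover-lit-balaban-p37-g2-0), HOME
`run/shared/lean/pub/lit-balaban/` (STATUS: `lit-balaban-p37/STATUS.md`), 2026-08-21.
-/

open scoped BigOperators

namespace Literature.MathematicalPhysics.QuantumFieldTheory.Balaban1983to89

namespace B5HierAxialGaugeV1

open LatticeFieldCalculus B5Eq120IterProof

variable {P : Params} {V : Type*} [AddCommGroup V] [Module ℝ V]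

/-! ## 1. One level: «`B − ∂g` axial» ⟺ the block-axial data of `g` are those of `B` -/

section OneLevel

variable {j : ℕ}

/-- Every fine site is the site of offset `r` in the block over `blockOf x`, for a unique offset (standing range). [folklore] -/
private theorem exists_blockSite_eq (hj : j + 1 ≤ P.m + P.K) (x : Site P j) :
    ∃ r : Fin P.d → Fin P.L, Site.blockSite (blockOf x) r = x :=
  ⟨Site.blockEquiv hj (blockOf x) ⟨x, rfl⟩,
    congrArg Subtype.val ((Site.blockEquiv hj (blockOf x)).left_inv ⟨x, rfl⟩)⟩

/-- **(1.10) for a gauge-transformed field, via the staircase telescoping.**  For a bond field `B` and a site function `g` on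
`T^{(j)}` and a lattice factor `c' ≠ 0`:  `B − ∂g` is in the block axial gauge (`A(Γ_{y,x}) = 0`, `x ∈ B(y)`) iff
`g(x) − g(y) = c'⁻¹·B(Γ_{y,x})` for every coarse `y` and every `x ∈ B(y)` (centred blocks, `y ↦ emb y`).
[cite: Balaban1984PropagatorsI, (1.10) p.19] -/
theorem isAxial_gaugeShift_iff {c' : ℝ} (hc : c' ≠ 0) (g : SiteField P j V) (B : VecField P j V) :
    IsAxial (gaugeShift c' g B) ↔
      ∀ (y : Site P (j + 1)) (r : Fin P.d → Fin P.L),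
        g (Site.blockSite y r) - g (emb y) = c'⁻¹ • stairSum B (emb y) (Site.blockSite y r) := by
  have key : ∀ (y : Site P (j + 1)) (r : Fin P.d → Fin P.L),
      stairSum (gaugeShift c' g B) (emb y) (Site.blockSite y r)
        = stairSum B (emb y) (Site.blockSite y r) - c' • (g (Site.blockSite y r) - g (emb y)) := by
    intro y r
    have h : gaugeShift c' g B = fun b => B b - grad c' g b := rfl
    rw [h, stairSum_sub, stairSum_grad]
  constructor
  · intro hA y r
    by_cases hx : Site.blockSite y r = emb y
    · rw [hx, stairSum_self, sub_self, smul_zero]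
    · have h0 := hA y r hx
      rw [key] at h0
      rw [sub_eq_zero.mp h0, smul_smul, inv_mul_cancel₀ hc, one_smul]
  · intro h y r _
    rw [key, h y r, smul_smul, mul_inv_cancel₀ hc, one_smul, sub_self]

end OneLevel

/-! ## 2. Level `j < k`: the block-axial data that `A` prescribes for `Q′_jλ` -/

section Data

/-- The block-axial data of level `j` prescribed by `A`: `a_j(x) = (L^j/c)·(Q_jA)(Γ_{y,x})`, `x ∈ B(y)` — by (1.20)
`Q_jA^λ = Q_jA − ∂^{(j)}Q′_jλ` (coarse factor `c/L^j`), «`Q_jA^λ` axial» says `(Q′_jλ)(x) − (Q′_jλ)(y) = a_j(x)`.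
[cite: Balaban1984PropagatorsI, (1.20) p.20] -/
noncomputable def axialData (c : ℝ) (A : VecField P 0 V) (j : ℕ) : SiteField P j V :=
  fun x => (c / (P.L : ℝ) ^ j)⁻¹ • stairSum (bondAvgIter j A) (emb (blockOf x)) x

/-- The prescribed data vanish at the block centres (`Γ_{y,y}` is empty) — the admissibility condition `ha` of
`B5.HierGauge.complete`. [cite: Balaban1984PropagatorsI, (1.10) p.19] -/
theorem axialData_emb {j : ℕ} (hj : j + 1 ≤ P.m + P.K) (c : ℝ) (A : VecField P 0 V) (y : Site P (j + 1)) :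
    axialData c A j (emb y) = 0 := by
  simp [axialData, Site.blockOf_emb hj, stairSum_self]

/-- **Level `j` of (1.17)/(1.23) read on `λ`:** for `j < k ≤ m + K` and `c ≠ 0`, `Q_jA^λ = bondAvgIter j (A − ∂λ)` is axial iff
the block-axial data of `Q′_jλ = siteAvgIter j λ` are `a_j`: `(Q′_jλ)(x) − (Q′_jλ)(y(x)) = a_j(x)` for all `x` (`y(x) = emb (blockOf x)`
the centre of the block of `x`). [cite: Balaban1984PropagatorsI, (1.20) p.20] -/
theorem isAxial_level_iff {k j : ℕ} (hk : k ≤ P.m + P.K) (hj : j < k) {c : ℝ} (hc : c ≠ 0) (lam : SiteField P 0 V)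
    (A : VecField P 0 V) :
    IsAxial (bondAvgIter j (gaugeShift c lam A)) ↔
      ∀ x : Site P j, siteAvgIter j lam x - siteAvgIter j lam (emb (blockOf x)) = axialData c A j x := by
  have hjr : j + 1 ≤ P.m + P.K := by omega
  have hc' : c / (P.L : ℝ) ^ j ≠ 0 :=
    div_ne_zero hc (pow_ne_zero _ (Nat.cast_ne_zero.mpr P.L_pos.ne'))
  rw [bondAvgIter_gaugeShift j (by omega) c lam A, isAxial_gaugeShift_iff hc']
  constructor
  · intro h x
    obtain ⟨r, hr⟩ := exists_blockSite_eq hjr x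
    have h1 := h (blockOf x) r
    rw [hr] at h1
    rw [h1]
    rfl
  · intro h y r
    have h1 := h (Site.blockSite y r)
    rw [Site.blockOf_blockSite hjr] at h1
    rw [h1]
    simp only [axialData, Site.blockOf_blockSite hjr]

end Data

/-! ## 3. The top-down construction (`B5.HierGauge.build` on the V1 blocks) and EXISTENCE -/

section Build

/-- «fix λ level by level, from the unit lattice down to T_η»: the level-`j` function with top value `0` at level `k`, block means
matching the level above, and prescribed block-axial data `a_j` (= `B5.HierGauge.build` with `π = blockOf`, block mean = `siteAvg`).
[cite: Balaban1984PropagatorsI, (1.17) p.20] -/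
noncomputable def build (k : ℕ) (a : ∀ j, SiteField P j V) (j : ℕ) (x : Site P j) : V :=
  if _h : j < k then build k a (j + 1) (blockOf x) + a j x - siteAvg (a j) (blockOf x) else 0
termination_by k - j
decreasing_by omega

/-- Unfolding below the top level. [folklore] -/
private theorem build_of_lt (k : ℕ) (a : ∀ j, SiteField P j V) {j : ℕ} (hj : j < k) (x : Site P j) :
    build k a j x = build k a (j + 1) (blockOf x) + a j x - siteAvg (a j) (blockOf x) := by
  conv_lhs => rw [build]
  simp [hj]

/-- `build` vanishes at the top level (`Q′_kλ = 0`: `λ ∈ N(Q′_k)`). [folklore] -/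
private theorem build_top (k : ℕ) (a : ∀ j, SiteField P j V) (x : Site P k) : build k a k x = 0 := by
  conv_lhs => rw [build]
  simp

/-- Block average of (a function of the block) + v = that function + block average of v. [folklore] -/
private theorem siteAvg_lift_add {j : ℕ} (hj : j + 1 ≤ P.m + P.K) (w : SiteField P j V) (u : SiteField P (j + 1) V)
    (v : SiteField P j V) (hw : ∀ x, w x = u (blockOf x) + v x) :
    siteAvg w = fun y => u y + siteAvg v y := by
  funext y
  have h1 : siteAvg w y = siteAvg (fun _ => u y) y + siteAvg v y := by
    simp only [siteAvg, hw, Site.blockOf_blockSite hj, Finset.sum_add_distrib, smul_add]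
  rw [h1, siteAvg_const]

/-- `build` is hierarchical: each level is the block average of the level below (`Q′_{j+1} = Q′Q′_j`). [folklore] -/
private theorem siteAvg_build {k : ℕ} (hk : k ≤ P.m + P.K) (a : ∀ j, SiteField P j V) {j : ℕ} (hj : j < k) :
    siteAvg (build k a j) = build k a (j + 1) := by
  have hjr : j + 1 ≤ P.m + P.K := by omega
  rw [siteAvg_lift_add hjr (build k a j) (fun y => build k a (j + 1) y - siteAvg (a j) y) (a j)
    (fun x => by rw [build_of_lt k a hj]; abel)]
  funext y
  abel

/-- `build` realises the prescribed data when they vanish at the block centres. [folklore] -/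
private theorem build_data {k : ℕ} (hk : k ≤ P.m + P.K) (a : ∀ j, SiteField P j V)
    (ha : ∀ j, j < k → ∀ y : Site P (j + 1), a j (emb y) = 0) {j : ℕ} (hj : j < k) (x : Site P j) :
    build k a j x - build k a j (emb (blockOf x)) = a j x := by
  have hjr : j + 1 ≤ P.m + P.K := by omega
  rw [build_of_lt k a hj x, build_of_lt k a hj (emb (blockOf x)), Site.blockOf_emb hjr, ha j hj]
  abel

/-- The iterated averages of the bottom level of `build` are its levels. [folklore] -/
private theorem siteAvgIter_build {k : ℕ} (hk : k ≤ P.m + P.K) (a : ∀ j, SiteField P j V) :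
    ∀ j, j ≤ k → siteAvgIter j (build k a 0) = build k a j
  | 0, _ => rfl
  | j + 1, hj => by
    rw [siteAvgIter_succ, siteAvgIter_build hk a j (by omega), siteAvg_build hk a (by omega)]

/-- **EXISTENCE (`B5.HierGauge.complete` on V1): every field admits a restricted gauge transformation to the hierarchical
block-axial gauge.**  For `k ≤ m + K`, `c ≠ 0` and every `A` there is `λ` with `Q′_kλ = 0` and `Q_jA^λ` axial for all `j < k` —
the λ′ at which the shifted constraints `δ_Ax(Q_{k−1}A + ∂^{L^{−1}}Q′_{k−1}λ′)·…·δ_Ax(A + ∂^ηλ′)` of (1.23) are met.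
[cite: Balaban1984PropagatorsI, (1.23) p.21] -/
theorem hierAxial_exists {k : ℕ} (hk : k ≤ P.m + P.K) {c : ℝ} (hc : c ≠ 0) (A : VecField P 0 V) :
    ∃ lam : SiteField P 0 V, siteAvgIter k lam = 0 ∧ ∀ j, j < k → IsAxial (bondAvgIter j (gaugeShift c lam A)) := by
  refine ⟨build k (axialData c A) 0, ?_, fun j hj => ?_⟩
  · rw [siteAvgIter_build hk _ k le_rfl]
    funext x
    exact build_top k _ x
  · rw [isAxial_level_iff hk hj hc]
    intro x
    rw [siteAvgIter_build hk _ j hj.le]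
    exact build_data hk _ (fun j' hj' y => axialData_emb (by omega) c A y) hj x

end Build

/-! ## 4. UNIQUENESS (`B5.HierGauge.unique` on V1) and the `∃!` statement -/

section Unique

/-- Reconstruction of a level from its block averages and its block-axial data. [folklore] -/
private theorem reconstruct {j : ℕ} (hj : j + 1 ≤ P.m + P.K) (f : SiteField P j V) (x : Site P j) :
    f x = siteAvg f (blockOf x) + (f x - f (emb (blockOf x)))
      - siteAvg (fun z => f z - f (emb (blockOf z))) (blockOf x) := by
  rw [siteAvg_lift_add hj (fun z => f z - f (emb (blockOf z))) (fun y => -f (emb y)) f (fun z => by abel)]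
  beta_reduce
  abel

/-- **UNIQUENESS (`B5.HierGauge.unique` on V1): the hierarchical block-axial gauge leaves no residual freedom in `N(Q′_k)`.**
Two `λ`'s with `Q′_kλ = 0` putting all `Q_jA^λ`, `j < k`, in the axial gauge are equal.
[cite: Balaban1984PropagatorsI, (1.23) p.21] -/
theorem hierAxial_unique {k : ℕ} (hk : k ≤ P.m + P.K) {c : ℝ} (hc : c ≠ 0) (A : VecField P 0 V)
    {lam lam' : SiteField P 0 V}
    (htop : siteAvgIter k lam = 0) (hax : ∀ j, j < k → IsAxial (bondAvgIter j (gaugeShift c lam A)))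
    (htop' : siteAvgIter k lam' = 0) (hax' : ∀ j, j < k → IsAxial (bondAvgIter j (gaugeShift c lam' A))) :
    lam = lam' := by
  -- descending induction on the level: `Q′_jλ = Q′_jλ′` for `j = k, k−1, …, 0`
  suffices h : ∀ n j, j + n = k → siteAvgIter j lam = siteAvgIter j lam' by
    simpa [siteAvgIter_zero] using h k 0 (by omega)
  intro n
  induction n with
  | zero =>
    intro j hj
    rw [Nat.add_zero] at hj
    subst hj
    rw [htop, htop']
  | succ n ih =>
    intro j hj
    have hjk : j < k := by omega
    have hjr : j + 1 ≤ P.m + P.K := by omega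
    have hup : siteAvgIter (j + 1) lam = siteAvgIter (j + 1) lam' := ih (j + 1) (by omega)
    rw [siteAvgIter_succ, siteAvgIter_succ] at hup
    have hd := (isAxial_level_iff hk hjk hc lam A).1 (hax j hjk)
    have hd' := (isAxial_level_iff hk hjk hc lam' A).1 (hax' j hjk)
    funext x
    rw [reconstruct hjr (siteAvgIter j lam) x, reconstruct hjr (siteAvgIter j lam') x, hup]
    simp only [hd, hd']

/-- **The hierarchical block-axial gauge is a complete and unambiguous gauge fixing of `N(Q′_k)`** (the lemma behind the middle
term of (1.23), GAPS G-B5-01(ii), concretely on V1): for `k ≤ m + K`, `c ≠ 0` and every field `A` on the finest lattice there is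
EXACTLY ONE `λ` with `Q′_kλ = 0` such that `Q_jA^λ` is axial for every `j < k`. [cite: Balaban1984PropagatorsI, (1.23) p.21] -/
theorem hierAxial_existsUnique {k : ℕ} (hk : k ≤ P.m + P.K) {c : ℝ} (hc : c ≠ 0) (A : VecField P 0 V) :
    ∃! lam : SiteField P 0 V, siteAvgIter k lam = 0 ∧ ∀ j, j < k → IsAxial (bondAvgIter j (gaugeShift c lam A)) := by
  obtain ⟨lam, htop, hax⟩ := hierAxial_exists hk hc A
  exact ⟨lam, ⟨htop, hax⟩, fun lam' h' => hierAxial_unique hk hc A h'.1 h'.2 htop hax⟩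

end Unique

/-! ## 5. The linear-algebra form: slice ⊕ orbit coordinates of the field space (input of the Faddeev–Popov constant) -/

section Linear

/-- `gaugeShift` by `λ = 0` is the identity. [folklore] -/
private theorem gaugeShift_zero {j : ℕ} (c : ℝ) (A : VecField P j V) : gaugeShift c (0 : SiteField P j V) A = A := by
  funext b; simp [gaugeShift, grad]

/-- `(A − ∂λ₁) − ∂λ₂ = A − ∂(λ₁ + λ₂)`. [folklore] -/
private theorem gaugeShift_gaugeShift {j : ℕ} (c : ℝ) (l₁ l₂ : SiteField P j V) (A : VecField P j V) :
    gaugeShift c l₂ (gaugeShift c l₁ A) = gaugeShift c (l₁ + l₂) A := by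
  funext b; simp only [gaugeShift, grad, Pi.add_apply]; module

/-- `Q′(−λ) = −Q′λ`. [folklore] -/
private theorem siteAvg_neg {j : ℕ} (l : SiteField P j V) : siteAvg (-l) = -siteAvg l := by
  funext y; simp [siteAvg, Finset.sum_neg_distrib, smul_neg]

/-- `Q′_k(−λ) = −Q′_kλ`. [folklore] -/
private theorem siteAvgIter_neg : ∀ (k : ℕ) (l : SiteField P 0 V), siteAvgIter k (-l) = -siteAvgIter k l
  | 0, _ => rfl
  | k + 1, l => by rw [siteAvgIter_succ, siteAvgIter_succ, siteAvgIter_neg k l, siteAvg_neg]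

/-- `Q′_k 0 = 0`. [folklore] -/
private theorem siteAvgIter_zero_field : ∀ k : ℕ, siteAvgIter k (0 : SiteField P 0 V) = 0
  | 0 => rfl
  | k + 1 => by
    rw [siteAvgIter_succ, siteAvgIter_zero_field k]
    funext y; simp [siteAvg]

/-- `Q 0 = 0`. [folklore] -/
private theorem bondAvg_zero_field {j : ℕ} : bondAvg (0 : VecField P j V) = 0 := by
  funext b; simp [bondAvg, segSum]

/-- `Q_j 0 = 0`. [folklore] -/
private theorem bondAvgIter_zero_field : ∀ j : ℕ, bondAvgIter j (0 : VecField P 0 V) = 0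
  | 0 => rfl
  | j + 1 => by rw [bondAvgIter_succ, bondAvgIter_zero_field j, bondAvg_zero_field]

omit [Module ℝ V] in
/-- A run sum of the zero field vanishes. [folklore] -/
private theorem runSum_zero_field {j : ℕ} (x : Site P j) (μ : Fin P.d) (n : ℤ) :
    runSum (0 : VecField P j V) x μ n = 0 := by
  cases n <;> simp [runSum]

omit [Module ℝ V] in
/-- The zero field is in the axial gauge. [folklore] -/
private theorem isAxial_zero_field {j : ℕ} : IsAxial (0 : VecField P j V) := by
  intro y r _
  simp [stairSum, runSum_zero_field]

/-- **KERNEL: no pure gauge `∂λ`, `λ ∈ N(Q′_k)`, `λ ≠ 0`, has all its averages `Q_j(∂λ)` in the axial gauge** — injectivity of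
the slice ⊕ orbit coordinates `(axial slice) × N(Q′_k) → fields`. [cite: Balaban1984PropagatorsI, (1.23) p.21] -/
theorem kernel_trivial {k : ℕ} (hk : k ≤ P.m + P.K) {c : ℝ} (hc : c ≠ 0) {lam : SiteField P 0 V}
    (htop : siteAvgIter k lam = 0) (hax : ∀ j, j < k → IsAxial (bondAvgIter j (grad c lam))) : lam = 0 := by
  -- `∂λ = 0^{(−λ)}`: compare the two hierarchical gauge fixings `−λ` and `0` of the ZERO field
  have h1 : ∀ j, j < k → IsAxial (bondAvgIter j (gaugeShift c (-lam) (0 : VecField P 0 V))) := by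
    intro j hj
    have : gaugeShift c (-lam) (0 : VecField P 0 V) = grad c lam := by
      funext b; simp only [gaugeShift, grad, Pi.zero_apply, Pi.neg_apply]; module
    rw [this]
    exact hax j hj
  have h0 : ∀ j, j < k → IsAxial (bondAvgIter j (gaugeShift c (0 : SiteField P 0 V) (0 : VecField P 0 V))) := by
    intro j _
    rw [gaugeShift_zero, bondAvgIter_zero_field]
    exact isAxial_zero_field
  have htop' : siteAvgIter k (-lam) = 0 := by rw [siteAvgIter_neg, htop, neg_zero]
  have h := hierAxial_unique hk hc (0 : VecField P 0 V) htop' h1 (siteAvgIter_zero_field k) h0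
  exact neg_eq_zero.mp h

/-- **SLICE ⊕ ORBIT DECOMPOSITION of the field space**: every field `A` is UNIQUELY `A = A₀^{(−λ)} = A₀ + ∂λ` with `A₀` in the
hierarchical axial gauge (all `Q_jA₀`, `j < k`, axial) and `λ ∈ N(Q′_k)` — bijectivity of `(A₀, λ) ↦ A₀ + ∂λ`; since
`Q_k∂λ = ∂Q′_kλ = 0` ((1.20)) the same holds inside each fibre `{Q_kA = B}`.  This is the coordinate change whose (constant)
Jacobian is `z^{(k)} → z′^{(k)}` in (1.23). [cite: Balaban1984PropagatorsI, (1.23) p.21] -/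
theorem fibre_decomposition {k : ℕ} (hk : k ≤ P.m + P.K) {c : ℝ} (hc : c ≠ 0) (A : VecField P 0 V) :
    ∃! p : VecField P 0 V × SiteField P 0 V,
      (∀ j, j < k → IsAxial (bondAvgIter j p.1)) ∧ siteAvgIter k p.2 = 0 ∧ A = gaugeShift c (-p.2) p.1 := by
  obtain ⟨lam, ⟨htop, hax⟩, huniq⟩ := hierAxial_existsUnique hk hc A
  refine ⟨(gaugeShift c lam A, lam), ⟨hax, htop, ?_⟩, ?_⟩
  · show A = gaugeShift c (-lam) (gaugeShift c lam A)
    rw [gaugeShift_gaugeShift, add_neg_cancel, gaugeShift_zero]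
  · rintro ⟨A₀, lam'⟩ ⟨hax', htop', hA⟩
    have hA' : gaugeShift c lam' A = A₀ := by
      rw [hA, gaugeShift_gaugeShift, neg_add_cancel, gaugeShift_zero]
    have hl : lam' = lam := huniq lam' ⟨htop', fun j hj => by rw [hA']; exact hax' j hj⟩
    subst hl
    exact Prod.ext hA'.symm rfl

end Linear

end B5HierAxialGaugeV1

end Literature.MathematicalPhysics.QuantumFieldTheory.Balaban1983to89
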